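import Summits.FinalStateConjecture.FinalStateConjecture.Theses.RobustClausewiseGenericity
import Summits.FinalStateConjecture.FinalStateConjecture.Theorems.RobustClausewiseGenericityAssembly
import HarnessLib

/-!
# Crux `CensorshipRobust` (stmt-FinalStateConjecture-10131) · split child `TameAxisSuperposition` · birth skeleton

Line `interpolate-project-squash` for the piece `TameAxisSuperposition` (joint realisation of a tame probe and
a tame curve through `d`, the curve becoming a LOCAL coordinate axis) of the typed decomposition
`CensorshipWalls → TameAxisSuperposition → CensorshipRobust` (`censorshipRobust_of_subs`). Two registered stubs
and the kernel-checked composition `TameAxisSuperposition_of`: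

* `stub_crossInterpolant` — DIFFERENTIAL TOPOLOGY (no constraint equations; provable now, M): a jointly smooth
  `(m+1)`-parameter family `P` of initial data sets (members NOT required admissible off the cross) with
  `P ∘ L = G` on the hyperplane `{π = 0} = range L`, `P ∘ L₁ = γ` near `0` on the axis `L₁`, agreeing with `d`
  off one compact set, admissible on the hyperplane and outside a parameter ball (double cut-off: the
  `γ`-deformation is inserted only for small `|s|` and small `‖c‖`, where positivity of the interpolated metric
  `h_{G c} + χ(c)χ(s)(h_{γ s} − h_d)` is automatic).
* `stub_crossProjection` — CONSTRAINT PROJECTION WITH PARAMETERS (the PDE content; Corvino–Schoen 2006 /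
  Chruściel–Delay 2003 / Delay 2012 local solvability of the constraint map with compactly supported corrections,
  smooth in parameters): a jointly smooth family admissible on a hyperplane and outside a parameter ball is
  corrected, WITHOUT CHANGING ITS ADMISSIBLE MEMBERS, to a jointly smooth family agreeing with `d` off a compact
  set and admissible on a uniform slab `|π q| < ε` (IFT near the compact disc + tube lemma). Why it might fail:
  KIDs of `d` on the joint support (cokernel of the linearised constraint operator; second-order positive-energy
  obstruction on flat/stationary regions) — there the bet is that tame deformations are gauge/slice-wiggles and
  superpose by composition.

`TameAxisSuperposition_of` (real proof): reparametrise the corrected family by the PLATEAU SQUASH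
`Ψ q = q + (σ(π q) − π q) • e`, `σ t = t · b(t)` with `b` a smooth bump equal to `1` on `[−ε₁, ε₁]` and
supported in `(−2ε₁, 2ε₁)`, `ε₁ = min (ε/4) (ε₀/2)`: then `|π (Ψ q)| = |σ(π q)| < ε` (admissible everywhere),
`Ψ = id` on the hyperplane and on the axis near `0` (enrichment and local axis survive), joint smoothness by
`IsSmoothDataFamily.comp_contDiff`. The piece is defined here VERBATIM (as in the strategist's `Sketch.lean` /
the split child); after `route edit --split` it is the route decl `Theses.RobustClausewiseGenericity.TameAxisSuperposition`.
-/

noncomputable section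

namespace Summit.FinalStateConjecture.FinalStateConjecture.Cruxes.CensorshipRobust.TameAxisSuperpositionBirth

open Literature.Geometry.Lorentzian
open Summit.FinalStateConjecture.FinalStateConjecture.Theorems.RobustClausewiseGenericity (Tame)
open Set Function Filter Metric
open scoped Manifold ContDiff Topology

set_option linter.dupNamespace false

/-- The split child `TameAxisSuperposition`, verbatim. -/
def TameAxisSuperposition : Prop :=
  ∀ (X : Type) [TopologicalSpace X] [ChartedSpace Literature.Geometry.Lorentzian.E3 X] [IsManifold (𝓡 3) ((⊤ : ℕ∞) : WithTop ℕ∞) X] [T2Space X] [SecondCountableTopology X] [ConnectedSpace X], ∀ d ∈ Literature.Geometry.Lorentzian.admissibleVacuumData X, let Tame : (m : ℕ) → (EuclideanSpace ℝ (Fin m) → Literature.Geometry.Lorentzian.InitialDataSet (𝓡 3) X) → Prop := fun m G ↦ Literature.Geometry.Lorentzian.InitialDataSet.IsSmoothDataFamily m G ∧ G 0 = d ∧ (∀ c, G c ∈ Literature.Geometry.Lorentzian.admissibleVacuumData X) ∧ ∃ K : Set X, IsCompact K ∧ ∀ c, ∀ x ∉ K, (G c).h.inner x = d.h.inner x ∧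 (G c).k x = d.k x; ∀ (m : ℕ) (G : EuclideanSpace ℝ (Fin m) → Literature.Geometry.Lorentzian.InitialDataSet (𝓡 3) X) (γ : EuclideanSpace ℝ (Fin 1) → Literature.Geometry.Lorentzian.InitialDataSet (𝓡 3) X), Tame m G → Tame 1 γ → ∃ (n : ℕ) (G₁ : EuclideanSpace ℝ (Fin n) → Literature.Geometry.Lorentzian.InitialDataSet (𝓡 3) X) (L : EuclideanSpace ℝ (Fin m) →ₗ[ℝ] EuclideanSpace ℝ (Fin n)) (L₁ : EuclideanSpace ℝ (Fin 1) →ₗ[ℝ] EuclideanSpace ℝ (Fin n)), Function.Injective L ∧ Tame n G₁ ∧ (∀ c, G₁ (L c) = G c) ∧ ∃ ε : ℝ, 0 < ε ∧ ∀ s, ‖s‖ < ε → G₁ (L₁ s) = γ s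

/-- **stub_crossInterpolant** — the CROSS INTERPOLANT (differential topology with a double cut-off; members off
the cross need not solve the constraints). -/
theorem stub_crossInterpolant :
    ∀ (X : Type) [TopologicalSpace X] [ChartedSpace E3 X] [IsManifold (𝓡 3) ∞ X] [T2Space X]
      [SecondCountableTopology X] [ConnectedSpace X], ∀ d ∈ admissibleVacuumData X,
      ∀ (m : ℕ) (G : EuclideanSpace ℝ (Fin m) → InitialDataSet (𝓡 3) X)
        (γ : EuclideanSpace ℝ (Fin 1) → InitialDataSet (𝓡 3) X), Tame d m G → Tame d 1 γ →
        ∃ (P : EuclideanSpace ℝ (Fin (m + 1)) → InitialDataSet (𝓡 3) X)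
          (L : EuclideanSpace ℝ (Fin m) →ₗ[ℝ] EuclideanSpace ℝ (Fin (m + 1)))
          (L₁ : EuclideanSpace ℝ (Fin 1) →ₗ[ℝ] EuclideanSpace ℝ (Fin (m + 1)))
          (π : EuclideanSpace ℝ (Fin (m + 1)) →L[ℝ] ℝ) (ε₀ R : ℝ),
          Function.Injective L ∧ (∀ c, π (L c) = 0) ∧ (∀ s, π (L₁ s) = s 0) ∧ 0 < ε₀ ∧
          InitialDataSet.IsSmoothDataFamily (m + 1) P ∧
          (∃ K : Set X, IsCompact K ∧ ∀ q, ∀ x ∉ K, (P q).h.inner x = d.h.inner x ∧ (P q).k x = d.k x) ∧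
          (∀ c, P (L c) = G c) ∧ (∀ s, ‖s‖ < ε₀ → P (L₁ s) = γ s) ∧
          (∀ q, π q = 0 → P q ∈ admissibleVacuumData X) ∧
          (∀ q, R ≤ ‖q‖ → P q ∈ admissibleVacuumData X) := by
  sorry

/-- **stub_crossProjection** — CONSTRAINT PROJECTION WITH PARAMETERS (Corvino–Schoen / Chruściel–Delay local
solvability with compactly supported corrections, smooth in parameters; KID caveat): a jointly smooth family which
is admissible on a hyperplane and outside a parameter ball is corrected, keeping its admissible members, to one
which is admissible on a uniform slab. -/
theorem stub_crossProjection :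
    ∀ (X : Type) [TopologicalSpace X] [ChartedSpace E3 X] [IsManifold (𝓡 3) ∞ X] [T2Space X]
      [SecondCountableTopology X] [ConnectedSpace X], ∀ d ∈ admissibleVacuumData X,
      ∀ (N : ℕ) (P : EuclideanSpace ℝ (Fin N) → InitialDataSet (𝓡 3) X) (π : EuclideanSpace ℝ (Fin N) →L[ℝ] ℝ)
        (R : ℝ), InitialDataSet.IsSmoothDataFamily N P →
        (∃ K : Set X, IsCompact K ∧ ∀ q, ∀ x ∉ K, (P q).h.inner x = d.h.inner x ∧ (P q).k x = d.k x) →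
        (∀ q, π q = 0 → P q ∈ admissibleVacuumData X) →
        (∀ q, R ≤ ‖q‖ → P q ∈ admissibleVacuumData X) →
        ∃ (P' : EuclideanSpace ℝ (Fin N) → InitialDataSet (𝓡 3) X) (ε : ℝ), 0 < ε ∧
          InitialDataSet.IsSmoothDataFamily N P' ∧
          (∃ K : Set X, IsCompact K ∧ ∀ q, ∀ x ∉ K, (P' q).h.inner x = d.h.inner x ∧ (P' q).k x = d.k x) ∧
          (∀ q, P q ∈ admissibleVacuumData X → P' q = P q) ∧
          ∀ q, |π q| < ε → P' q ∈ admissibleVacuumData X := by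
  sorry

/-- **Composition** `stub_crossInterpolant → stub_crossProjection → TameAxisSuperposition`: interpolate across
the cross, project onto the constraints keeping the cross, and reparametrise the last coordinate by a plateau
squash `σ` (`σ = id` near `0`, `|σ| < ε`), so that the whole `(m+1)`-parameter family is admissible while the
hyperplane and the axis near `0` are untouched. -/
theorem TameAxisSuperposition_of :
    (∀ (X : Type) [TopologicalSpace X] [ChartedSpace E3 X] [IsManifold (𝓡 3) ∞ X] [T2Space X]
      [SecondCountableTopology X] [ConnectedSpace X], ∀ d ∈ admissibleVacuumData X,
      ∀ (m : ℕ) (G : EuclideanSpace ℝ (Fin m) → InitialDataSet (𝓡 3) X)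
        (γ : EuclideanSpace ℝ (Fin 1) → InitialDataSet (𝓡 3) X), Tame d m G → Tame d 1 γ →
        ∃ (P : EuclideanSpace ℝ (Fin (m + 1)) → InitialDataSet (𝓡 3) X)
          (L : EuclideanSpace ℝ (Fin m) →ₗ[ℝ] EuclideanSpace ℝ (Fin (m + 1)))
          (L₁ : EuclideanSpace ℝ (Fin 1) →ₗ[ℝ] EuclideanSpace ℝ (Fin (m + 1)))
          (π : EuclideanSpace ℝ (Fin (m + 1)) →L[ℝ] ℝ) (ε₀ R : ℝ),
          Function.Injective L ∧ (∀ c, π (L c) = 0) ∧ (∀ s, π (L₁ s) = s 0) ∧ 0 < ε₀ ∧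
          InitialDataSet.IsSmoothDataFamily (m + 1) P ∧
          (∃ K : Set X, IsCompact K ∧ ∀ q, ∀ x ∉ K, (P q).h.inner x = d.h.inner x ∧ (P q).k x = d.k x) ∧
          (∀ c, P (L c) = G c) ∧ (∀ s, ‖s‖ < ε₀ → P (L₁ s) = γ s) ∧
          (∀ q, π q = 0 → P q ∈ admissibleVacuumData X) ∧
          (∀ q, R ≤ ‖q‖ → P q ∈ admissibleVacuumData X)) →
    (∀ (X : Type) [TopologicalSpace X] [ChartedSpace E3 X] [IsManifold (𝓡 3) ∞ X] [T2Space X]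
      [SecondCountableTopology X] [ConnectedSpace X], ∀ d ∈ admissibleVacuumData X,
      ∀ (N : ℕ) (P : EuclideanSpace ℝ (Fin N) → InitialDataSet (𝓡 3) X) (π : EuclideanSpace ℝ (Fin N) →L[ℝ] ℝ)
        (R : ℝ), InitialDataSet.IsSmoothDataFamily N P →
        (∃ K : Set X, IsCompact K ∧ ∀ q, ∀ x ∉ K, (P q).h.inner x = d.h.inner x ∧ (P q).k x = d.k x) →
        (∀ q, π q = 0 → P q ∈ admissibleVacuumData X) →
        (∀ q, R ≤ ‖q‖ → P q ∈ admissibleVacuumData X) →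
        ∃ (P' : EuclideanSpace ℝ (Fin N) → InitialDataSet (𝓡 3) X) (ε : ℝ), 0 < ε ∧
          InitialDataSet.IsSmoothDataFamily N P' ∧
          (∃ K : Set X, IsCompact K ∧ ∀ q, ∀ x ∉ K, (P' q).h.inner x = d.h.inner x ∧ (P' q).k x = d.k x) ∧
          (∀ q, P q ∈ admissibleVacuumData X → P' q = P q) ∧
          ∀ q, |π q| < ε → P' q ∈ admissibleVacuumData X) →
    TameAxisSuperposition := by
  intro hI hP X _ _ _ _ _ _ d hd
  dsimp only
  intro m G γ hG hγ
  obtain ⟨P, L, L₁, π, ε₀, R, hL, hπL, hπL₁, hε₀, hPs, hPK, hPG, hPγ, hP0, hPR⟩ := hI X d hd m G γ hG hγ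
  obtain ⟨P', ε, hε, hP's, ⟨K', hK', hP'K⟩, hP'P, hP'adm⟩ := hP X d hd (m + 1) P π R hPs hPK hP0 hPR
  -- the plateau squash `σ t = t · b t`
  obtain ⟨ε₁, hε₁pos, hε₁ε, hε₁ε₀⟩ : ∃ ε₁ : ℝ, 0 < ε₁ ∧ 4 * ε₁ ≤ ε ∧ 2 * ε₁ ≤ ε₀ :=
    ⟨min (ε / 4) (ε₀ / 2), lt_min (by positivity) (by positivity),
      by linarith [min_le_left (ε / 4) (ε₀ / 2)], by linarith [min_le_right (ε / 4) (ε₀ / 2)]⟩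
  let b : ContDiffBump (0 : ℝ) := ⟨ε₁, 2 * ε₁, hε₁pos, by linarith⟩
  let σ : ℝ → ℝ := fun t => t * b t
  have hσs : ContDiff ℝ ∞ σ := contDiff_id.mul b.contDiff
  have hσid : ∀ t : ℝ, |t| ≤ ε₁ → σ t = t := fun t ht => by
    show t * b t = t
    rw [b.one_of_mem_closedBall (by rw [Metric.mem_closedBall, Real.dist_eq, sub_zero]; exact ht), mul_one]
  have hσlt : ∀ t : ℝ, |σ t| < ε := fun t => by
    show |t * b t| < ε
    by_cases ht : 2 * ε₁ ≤ |t|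
    · rw [b.zero_of_le_dist (by rw [Real.dist_eq, sub_zero]; exact ht), mul_zero, abs_zero]
      exact hε
    · push Not at ht
      calc |t * b t| = |t| * b t := by rw [abs_mul, abs_of_nonneg b.nonneg]
        _ ≤ |t| * 1 := mul_le_mul_of_nonneg_left b.le_one (abs_nonneg t)
        _ < ε := by linarith
  -- the reparametrisation `Ψ q = q + (σ (π q) - π q) • e`
  let e : EuclideanSpace ℝ (Fin (m + 1)) := L₁ (EuclideanSpace.single 0 1)
  have hπe : π e = 1 := by
    show π (L₁ (EuclideanSpace.single 0 1)) = 1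
    rw [hπL₁]
    simp
  let Ψ : EuclideanSpace ℝ (Fin (m + 1)) → EuclideanSpace ℝ (Fin (m + 1)) :=
    fun q => q + (σ (π q) - π q) • e
  have hΨs : ContDiff ℝ ∞ Ψ :=
    contDiff_id.add (((hσs.comp π.contDiff).sub π.contDiff).smul contDiff_const)
  have hπΨ : ∀ q, π (Ψ q) = σ (π q) := fun q => by
    show π (q + (σ (π q) - π q) • e) = σ (π q)
    rw [map_add, map_smul, hπe, smul_eq_mul, mul_one]
    ring
  have hΨfix : ∀ q, |π q| ≤ ε₁ → Ψ q = q := fun q hq => by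
    show q + (σ (π q) - π q) • e = q
    rw [hσid _ hq, sub_self, zero_smul, add_zero]
  refine ⟨m + 1, fun q => P' (Ψ q), L, L₁, hL,
    ⟨hP's.comp_contDiff hΨs, ?_, fun q => hP'adm _ ?_, K', hK', fun q x hx => hP'K _ x hx⟩,
    fun c => ?_, ε₁, hε₁pos, fun s hs => ?_⟩
  · -- base point: `Ψ 0 = 0`, `P' 0 = P 0 = G 0 = d`
    show P' (Ψ 0) = d
    have hΨ0 : Ψ 0 = 0 := hΨfix 0 (by rw [map_zero, abs_zero]; exact hε₁pos.le)
    have hPG0 : P 0 = G 0 := by simpa using hPG 0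
    rw [hΨ0, hP'P 0 (hP0 0 (map_zero π)), hPG0, hG.2.1]
  · -- admissibility everywhere: `|π (Ψ q)| = |σ (π q)| < ε`
    rw [hπΨ]
    exact hσlt _
  · -- the enrichment survives: `Ψ (L c) = L c`, `P' (L c) = P (L c) = G c`
    show P' (Ψ (L c)) = G c
    rw [hΨfix (L c) (by rw [hπL c, abs_zero]; exact hε₁pos.le), hP'P _ (hP0 _ (hπL c)), hPG]
  · -- the local axis survives: `‖s‖ < ε₁ ⇒ Ψ (L₁ s) = L₁ s`, `P' (L₁ s) = P (L₁ s) = γ s`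
    show P' (Ψ (L₁ s)) = γ s
    have hs0 : |s 0| ≤ ε₁ := by
      have h := PiLp.norm_apply_le s 0
      rw [Real.norm_eq_abs] at h
      exact h.trans hs.le
    have hsε₀ : ‖s‖ < ε₀ := by linarith
    have hPγs : P (L₁ s) = γ s := hPγ s hsε₀
    rw [hΨfix (L₁ s) (by rw [hπL₁]; exact hs0), hP'P _ (by rw [hPγs]; exact hγ.2.2.1 s), hPγs]

end Summit.FinalStateConjecture.FinalStateConjecture.Cruxes.CensorshipRobust.TameAxisSuperpositionBirth

end
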